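import Summits.HubbardSuperconductivity.HubbardSuperconductivity.Theorems.AnisotropyChordTransferFibre3FinXB2Sound

/-!
# Route `AnisotropyChord` / H0 rotor rung: FIN mid-`L` evaluator XB2 — per-momentum soundness with a general `T`-table, direction folding

Soundness layer 2a of `…Fibre3FinXB2Eval` (XB2 analogue of g5's `…FinXBDisc`): table lookups (`getT_tab`, `getT_momTab`,
`getT_dscTab`, `momAt_fst`); g5's per-momentum lemmas restated for an ARBITRARY two-propagator table enclosing `T` (`TTabOK`,
`mem_tAt'`, `mem_fAt'`, `mem_momU`, ★ `discOf_sound`, `dscAt_abs_n2`, ★ `dscAt_disc`, `crossOfA_eq`); the direction folding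
`φ̂_{−e}(k) = conj φ̂_e(k)` for an even profile (`phiHat_negDir`, `normSq_negDir`, `cross_negDir`, `eDir_one/three`, `sum_dir4`) by
which the four-direction sums of `PiC0OneLoop` / `BCOneLoop` are twice the two-direction sums evaluated by XB2.
Prover seat `hubbard-h0-rotor-p3` g6; helper for piece A = stmt-HubbardSuperconductivity-23918 of rung 19089 (`--supports`, helper
class).  WHAT THIS IS NOT: nothing here proves superconductivity in the Hubbard model (rotor TARGET as worded stays FALSE, g15 verdict);
soundness lemmas for the FIN certificates of ONE conditional reduction.  Tree imports only; no sorry, no new axioms.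
-/

set_option linter.dupNamespace false
set_option autoImplicit false

namespace Summit.HubbardSuperconductivity.HubbardSuperconductivity.Theorems.AnisotropyChord.Transfer.Fibre3

namespace FinXB

open scoped BigOperators
open Finset Hole2 FinCell

variable {L : ℕ} [NeZero L]

/-! ## Table lookups -/

omit [NeZero L] in
/-- entries of a `range`-built table of any type. [folklore] -/
theorem getT_tab {α : Type} [Inhabited α] (g : ℕ → ℕ → α) {i j : ℕ} (hi : i < L) (hj : j < L) :
    getT ((List.range L).map fun k1 => (List.range L).map fun k2 => g k1 k2) i j = g i j := by
  unfold getT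
  rw [getD_map_range _ _ hi, getD_map_range _ _ hj]

omit [NeZero L] in
/-- entries of the per-momentum table. [folklore] -/
theorem getT_momTab (S : XBScal) (gt tt : List (List Iv)) {i j : ℕ} (hi : i < L) (hj : j < L) :
    getT (momTab L S gt tt) i j = momAt L S gt tt i j := by
  unfold momTab; exact getT_tab _ hi hj

omit [NeZero L] in
/-- entries of the direction table. [folklore] -/
theorem getT_dscTab (S : XBScal) (mt : List (List (Iv × Iv))) (ct ct4 : List Iv) (j : ℕ) {i i' : ℕ}
    (hi : i < L) (hi' : i' < L) : getT (dscTab L S mt ct ct4 j) i i' = dscAt L S mt ct ct4 j i i' := by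
  unfold dscTab; exact getT_tab _ hi hi'

omit [NeZero L] in
/-- the first component of the per-momentum record is g5's `fAt`. [folklore] -/
theorem momAt_fst (S : XBScal) (gt tt : List (List Iv)) (k1 k2 : ℕ) :
    (momAt L S gt tt k1 k2).1 = fAt L S gt tt k1 k2 := by
  unfold momAt fAt
  split_ifs <;> rfl

/-! ## Per-momentum soundness for an arbitrary `T`-table -/

/-- the hypothesis on a `T`-table: it encloses `T(k)` at every natural momentum. -/
def TTabOK (L : ℕ) [NeZero L] (lam : ℝ) (tt : List (List Iv)) : Prop :=
  ∀ k1 k2 : ℕ, k1 < L → k2 < L →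
    mem (∑ p : Tor L, gres L lam p * gres L lam (p - ((((k1 : ℕ) : ZMod L), ((k2 : ℕ) : ZMod L)) : Tor L)))
      (getF tt k1 k2)

/-- `t(k) ∈ tAt` for `k ≠ 0` (cf. `mem_tAt`). [folklore] -/
theorem mem_tAt' (hL : 5 ≤ L) {Δ lam2 : ℝ} (hΔ0 : 0 ≤ Δ) {f : Tor L → ℝ}
    (hf : IsGroundTwoMagnon L Δ lam2 f) {la lb : ℤ}
    (hla : (la : ℝ) ≤ lam2 * ((D : ℤ) : ℝ)) (hlb : lam2 * ((D : ℤ) : ℝ) ≤ (lb : ℝ))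
    (hpos : denCellPos L (cosTab L) la lb = true) {S : XBScal} (hS : ScalOK L Δ lam2 f S)
    {tt : List (List Iv)} (htt : TTabOK L lam2 tt)
    {k1 k2 : ℕ} (hk1 : k1 < L) (hk2 : k2 < L) (hk : ¬ (k1 = 0 ∧ k2 = 0)) :
    mem (tfun L Δ f ((((k1 : ℕ) : ZMod L), ((k2 : ℕ) : ZMod L))))
      (tAt L S (gresCellTab L (cosTab L) la lb) tt k1 k2) := by
  have hL3 : 3 ≤ L := by omega
  obtain ⟨_, mcs, ma, -⟩ := hS
  have hkne : ((((k1 : ℕ) : ZMod L), ((k2 : ℕ) : ZMod L)) : Tor L) ≠ 0 := by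
    rw [Ne, Prod.mk_eq_zero, natCast_zmod_eq_zero L hk1, natCast_zmod_eq_zero L hk2]; exact hk
  rw [tfun_eq_conv L hL hΔ0 hf hkne]
  unfold tAt
  have hLL : (0 : ℤ) < (L : ℤ) * L := by
    have : (0 : ℤ) < L := by exact_mod_cast (show 0 < L by omega)
    positivity
  have h := mem_idivn (mem_isub (mem_imul (mem_imul mcs mcs) (htt k1 k2 hk1 hk2))
    (by
      have := mem_iscale 2 (mem_imul (mem_imul ma mcs) (mem_gAt L hL3 hla hlb hpos hk1 hk2))
      exact this)) hLL
  have e : (cS L Δ lam2 f * cS L Δ lam2 f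
        * (∑ p : Tor L, gres L lam2 p * gres L lam2 (p - ((((k1 : ℕ) : ZMod L), ((k2 : ℕ) : ZMod L)) : Tor L)))
        - ((2 : ℕ) : ℝ) * (Δ * f (K1 L) * cS L Δ lam2 f * gres L lam2 ((((k1 : ℕ) : ZMod L), ((k2 : ℕ) : ZMod L)))))
        / ((((L : ℤ) * L : ℤ)) : ℝ)
      = (cS L Δ lam2 f ^ 2
          * (∑ p : Tor L, gres L lam2 p * gres L lam2 (p - ((((k1 : ℕ) : ZMod L), ((k2 : ℕ) : ZMod L)) : Tor L)))
          - 2 * (Δ * f (K1 L)) * cS L Δ lam2 f * gres L lam2 ((((k1 : ℕ) : ZMod L), ((k2 : ℕ) : ZMod L))))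
        / (L : ℝ) ^ 2 := by
    push_cast; ring
  rwa [e] at h

/-- `F₂(k) ∈ fAt` for every `k` (cf. `mem_fAt`). [folklore] -/
theorem mem_fAt' (hL : 5 ≤ L) {Δ lam2 : ℝ} (hΔ0 : 0 ≤ Δ) {f : Tor L → ℝ}
    (hf : IsGroundTwoMagnon L Δ lam2 f) {la lb : ℤ}
    (hla : (la : ℝ) ≤ lam2 * ((D : ℤ) : ℝ)) (hlb : lam2 * ((D : ℤ) : ℝ) ≤ (lb : ℝ))
    (hpos : denCellPos L (cosTab L) la lb = true) {S : XBScal} (hS : ScalOK L Δ lam2 f S) (hlam : 0 < lam2)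
    {tt : List (List Iv)} (htt : TTabOK L lam2 tt)
    {k1 k2 : ℕ} (hk1 : k1 < L) (hk2 : k2 < L) :
    mem (F2 L f ((((k1 : ℕ) : ZMod L), ((k2 : ℕ) : ZMod L))))
      (fAt L S (gresCellTab L (cosTab L) la lb) tt k1 k2) := by
  have hL3 : 3 ≤ L := by omega
  have hF := OuterMaj.f2ClosedPlusTail_holds L hL hΔ0 lam2 f hf hlam
  have mcs := hS.2.1
  have md := hS.2.2.2.2.2.1
  have mnf2 := hS.2.2.2.2.2.2.2.1
  unfold fAt
  by_cases hk : k1 = 0 ∧ k2 = 0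
  · rw [if_pos hk]
    obtain ⟨rfl, rfl⟩ := hk
    have e : ((((0 : ℕ) : ZMod L), (((0 : ℕ) : ZMod L))) : Tor L) = 0 := by ext <;> simp
    rw [e, hF.1]
    exact mnf2
  · rw [if_neg hk]
    have hkne : ((((k1 : ℕ) : ZMod L), ((k2 : ℕ) : ZMod L)) : Tor L) ≠ 0 := by
      rw [Ne, Prod.mk_eq_zero, natCast_zmod_eq_zero L hk1, natCast_zmod_eq_zero L hk2]; exact hk
    rw [hF.2 _ hkne]
    unfold cK
    have h2 := mem_iscale 2 (mem_imul mcs (mem_gAt L hL3 hla hlb hpos hk1 hk2))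
    have h := mem_iadd (mem_ineg (mem_iadd h2 md)) (mem_tAt' hL hΔ0 hf hla hlb hpos hS htt hk1 hk2 hk)
    have e : -(2 * cS L Δ lam2 f * gres L lam2 ((((k1 : ℕ) : ZMod L), ((k2 : ℕ) : ZMod L))) + dPar L Δ f)
          + tfun L Δ f ((((k1 : ℕ) : ZMod L), ((k2 : ℕ) : ZMod L)))
        = -(((2 : ℕ) : ℝ) * (cS L Δ lam2 f * gres L lam2 ((((k1 : ℕ) : ZMod L), ((k2 : ℕ) : ZMod L)))) + dPar L Δ f)
          + tfun L Δ f ((((k1 : ℕ) : ZMod L), ((k2 : ℕ) : ZMod L))) := by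
      push_cast; ring
    rw [e]; exact h

/-- `u(k) = t(k)/2 − β(k)` lies in the second component of the per-momentum record (`k ≠ 0`). [folklore] -/
theorem mem_momU (hL : 5 ≤ L) {Δ lam2 : ℝ} (hΔ0 : 0 ≤ Δ) {f : Tor L → ℝ}
    (hf : IsGroundTwoMagnon L Δ lam2 f) {la lb : ℤ}
    (hla : (la : ℝ) ≤ lam2 * ((D : ℤ) : ℝ)) (hlb : lam2 * ((D : ℤ) : ℝ) ≤ (lb : ℝ))
    (hpos : denCellPos L (cosTab L) la lb = true) {S : XBScal} (hS : ScalOK L Δ lam2 f S)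
    {tt : List (List Iv)} (htt : TTabOK L lam2 tt)
    {k1 k2 : ℕ} (hk1 : k1 < L) (hk2 : k2 < L) (hk : ¬ (k1 = 0 ∧ k2 = 0)) :
    mem (tfun L Δ f ((((k1 : ℕ) : ZMod L), ((k2 : ℕ) : ZMod L))) / ((2 : ℤ) : ℝ)
        - betaK L Δ lam2 f ((((k1 : ℕ) : ZMod L), ((k2 : ℕ) : ZMod L))))
      (momAt L S (gresCellTab L (cosTab L) la lb) tt k1 k2).2 := by
  have hL3 : 3 ≤ L := by omega
  unfold momAt
  rw [if_neg hk]
  have ht := mem_tAt' hL hΔ0 hf hla hlb hpos hS htt hk1 hk2 hk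
  have hb := mem_betaAt L hL3 hla hlb hpos hS hk1 hk2
  unfold betaAt at hb
  exact mem_isub (mem_idivn ht (by norm_num : (0:ℤ) < 2)) hb

/-- ★ the disc from `u(k)` and the direction phase encloses `φ̂_e(k)` (`k ≠ 0`; cf. `disc_sound`). [folklore] -/
theorem discOf_sound (hL : 5 ≤ L) {Δ lam2 : ℝ} (hΔ0 : 0 ≤ Δ) {f : Tor L → ℝ}
    (hf : IsGroundTwoMagnon L Δ lam2 f) (hlam : 0 < lam2) {S : XBScal} (hS : ScalOK L Δ lam2 f S)
    {j : ℕ} (hj : j < 4) {k1 k2 : ℕ} (hk1 : k1 < L) (hk2 : k2 < L) (hk : ¬ (k1 = 0 ∧ k2 = 0))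
    {u : Iv} (hu : mem (tfun L Δ f ((((k1 : ℕ) : ZMod L), ((k2 : ℕ) : ZMod L))) / ((2 : ℤ) : ℝ)
        - betaK L Δ lam2 f ((((k1 : ℕ) : ZMod L), ((k2 : ℕ) : ZMod L)))) u) :
    DiscOK (phiHat L f (eDir L j) ((((k1 : ℕ) : ZMod L), ((k2 : ℕ) : ZMod L))))
      (discOf S u (cosAt L (cosTab L) j k1 k2) (sinAt L (cosTab (4 * L)) j k1 k2)) := by
  have hL3 : 3 ≤ L := by omega
  have hkne : ((((k1 : ℕ) : ZMod L), ((k2 : ℕ) : ZMod L)) : Tor L) ≠ 0 := by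
    rw [Ne, Prod.mk_eq_zero, natCast_zmod_eq_zero L hk1, natCast_zmod_eq_zero L hk2]; exact hk
  unfold discOf
  refine ⟨mC L Δ lam2 f (eDir L j) _, tauBar L Δ lam2 f / 2,
    phiHat_near_mC L hL hΔ0 hf hlam (eDir_mem L j) hkne, ?_, ?_, ?_⟩
  · rw [mC_re]
    have hc := mem_cosAt L hL3 hj hk1 hk2
    have h2 : (0 : ℤ) < 2 := by norm_num
    have h := mem_iadd (mem_imul (mem_isub mem_one hc) hu)
      (mem_imul (mem_idivn hS.2.2.2.2.2.2.1 h2) (mem_iadd mem_one hc))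
    push_cast at h
    exact h
  · rw [mC_im]
    have hs := mem_sinAt L hL3 hj hk1 hk2
    have h2 : (0 : ℤ) < 2 := by norm_num
    have h := mem_imul hs (mem_isub hu (mem_idivn hS.2.2.2.2.2.2.1 h2))
    push_cast at h
    exact h
  · have h := mem_idivn hS.2.2.2.2.2.2.2.2.1 (by norm_num : (0:ℤ) < 2)
    push_cast at h
    exact h

omit [NeZero L] in
/-- components 4 and 5 of the direction record are the modulus bracket and g5's `n2Of`. [folklore] -/
theorem dscAt_abs_n2 (S : XBScal) (mt : List (List (Iv × Iv))) (ct ct4 : List Iv) (j k1 k2 : ℕ) :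
    (dscAt L S mt ct ct4 j k1 k2).2.2.2.1 = absIv (dscAt L S mt ct ct4 j k1 k2).1 (dscAt L S mt ct ct4 j k1 k2).2.1 ∧
    (dscAt L S mt ct ct4 j k1 k2).2.2.2.2
      = n2Of ((dscAt L S mt ct ct4 j k1 k2).1, (dscAt L S mt ct ct4 j k1 k2).2.1, (dscAt L S mt ct ct4 j k1 k2).2.2.1) := by
  unfold dscAt
  by_cases hk : k1 = 0 ∧ k2 = 0
  · rw [if_pos hk]
    exact ⟨rfl, rfl⟩
  · rw [if_neg hk]
    exact ⟨rfl, rfl⟩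

/-- ★ the first three components of the direction record enclose `φ̂_e(k)` for every `k` (XB2 analogue of `disc_sound`). [folklore] -/
theorem dscAt_disc (hL : 5 ≤ L) {Δ lam2 : ℝ} (hΔ0 : 0 ≤ Δ) {f : Tor L → ℝ}
    (hf : IsGroundTwoMagnon L Δ lam2 f) (hlam : 0 < lam2) {la lb : ℤ}
    (hla : (la : ℝ) ≤ lam2 * ((D : ℤ) : ℝ)) (hlb : lam2 * ((D : ℤ) : ℝ) ≤ (lb : ℝ))
    (hpos : denCellPos L (cosTab L) la lb = true) {S : XBScal} (hS : ScalOK L Δ lam2 f S)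
    {tt : List (List Iv)} (htt : TTabOK L lam2 tt)
    {j : ℕ} (hj : j < 4) {k1 k2 : ℕ} (hk1 : k1 < L) (hk2 : k2 < L) :
    let d := dscAt L S (momTab L S (gresCellTab L (cosTab L) la lb) tt) (cosTab L) (cosTab (4 * L)) j k1 k2
    DiscOK (phiHat L f (eDir L j) ((((k1 : ℕ) : ZMod L), ((k2 : ℕ) : ZMod L)))) (d.1, d.2.1, d.2.2.1) := by
  intro d
  show DiscOK _ (d.1, d.2.1, d.2.2.1)
  by_cases hk : k1 = 0 ∧ k2 = 0
  · have hd : d = (S.gam, (0, 0), (0, 0), absIv S.gam (0, 0), n2OfA (absIv S.gam (0, 0)) (0, 0)) := by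
      show dscAt L S _ _ _ j k1 k2 = _
      unfold dscAt; rw [if_pos hk]
    rw [hd]
    obtain ⟨rfl, rfl⟩ := hk
    have e : ((((0 : ℕ) : ZMod L), (((0 : ℕ) : ZMod L))) : Tor L) = 0 := by ext <;> simp
    rw [e, phiHat_zero_eq L hL hΔ0 hf hlam (eDir_mem L j)]
    refine ⟨((gamPar L Δ lam2 f : ℝ) : ℂ), 0, by simp, ?_, ?_, mem_zero⟩
    · rw [Complex.ofReal_re]; exact hS.2.2.2.2.2.2.2.2.2.1
    · rw [Complex.ofReal_im]; exact mem_zero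
  · have hu := mem_momU hL hΔ0 hf hla hlb hpos hS htt hk1 hk2 hk
    rw [← getT_momTab S _ tt hk1 hk2] at hu
    have hD := discOf_sound hL hΔ0 hf hlam hS hj hk1 hk2 hk hu
    have hd : (d.1, d.2.1, d.2.2.1) = discOf S (getT (momTab L S (gresCellTab L (cosTab L) la lb) tt) k1 k2).2
        (cosAt L (cosTab L) j k1 k2) (sinAt L (cosTab (4 * L)) j k1 k2) := by
      show ((dscAt L S _ _ _ j k1 k2).1, (dscAt L S _ _ _ j k1 k2).2.1, (dscAt L S _ _ _ j k1 k2).2.2.1) = _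
      unfold dscAt; rw [if_neg hk]
    rw [hd]; exact hD

omit [NeZero L] in
/-- the tabulated cross term is g5's `crossOf` on records whose 4th component is the modulus bracket. [folklore] -/
theorem crossOfA_eq (d1 d2 : Iv × Iv × Iv × Iv × Iv) (h1 : d1.2.2.2.1 = absIv d1.1 d1.2.1)
    (h2 : d2.2.2.2.1 = absIv d2.1 d2.2.1) :
    crossOfA d1 d2 = crossOf (d1.1, d1.2.1, d1.2.2.1) (d2.1, d2.2.1, d2.2.2.1) := by
  obtain ⟨re1, im1, r1, a1, n1⟩ := d1
  obtain ⟨re2, im2, r2, a2, n2⟩ := d2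
  simp only at h1 h2
  subst h1; subst h2
  rfl

/-! ## Direction folding: `φ̂_{−e} = conj φ̂_e` -/

/-- `φ̂_{−e}(k) = conj φ̂_e(k)` for an even profile. [folklore] -/
theorem phiHat_negDir {f : Tor L → ℝ} (hev : ∀ r : Tor L, f (-r) = f r) (e k : Tor L) :
    phiHat L f (-e) k = (starRingEnd ℂ) (phiHat L f e k) := by
  unfold phiHat
  rw [conj_dft_real]
  unfold dft
  rw [← Fintype.sum_equiv (Equiv.neg (Tor L))
    (fun r => (starRingEnd ℂ) (phase L k (-r)) * ((f (-r) * Dgrad L f (-e) (-r) : ℝ) : ℂ)) _ (fun r => rfl)]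
  refine Fintype.sum_congr _ _ fun r => ?_
  rw [← conj_phase, Complex.conj_conj, hfun_neg L hev (-e) r, neg_neg]

/-- the directions `1` and `3` are the negatives of `0` and `2`. [folklore] -/
theorem eDir_one : eDir L 1 = -eDir L 0 := by unfold eDir; simp
/-- the directions `1` and `3` are the negatives of `0` and `2`. [folklore] -/
theorem eDir_three : eDir L 3 = -eDir L 2 := by unfold eDir; simp

/-- `(a · conj b).re = (conj a · b).re`. [folklore] -/
theorem re_mul_conj_swap (a b : ℂ) : (a * (starRingEnd ℂ) b).re = ((starRingEnd ℂ) a * b).re := by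
  have : a * (starRingEnd ℂ) b = (starRingEnd ℂ) ((starRingEnd ℂ) a * b) := by
    rw [map_mul, Complex.conj_conj]
  rw [this, Complex.conj_re]

/-- `|φ̂_{−e}(k)|² = |φ̂_e(k)|²`. [folklore] -/
theorem normSq_negDir {f : Tor L → ℝ} (hev : ∀ r : Tor L, f (-r) = f r) (e k : Tor L) :
    Complex.normSq (phiHat L f (-e) k) = Complex.normSq (phiHat L f e k) := by
  rw [phiHat_negDir hev, Complex.normSq_conj]

/-- the cross term of `−e` equals that of `e`. [folklore] -/
theorem cross_negDir {f : Tor L → ℝ} (hev : ∀ r : Tor L, f (-r) = f r) (e k k' : Tor L) :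
    ((starRingEnd ℂ) (phiHat L f (-e) k) * phiHat L f (-e) k').re
      = ((starRingEnd ℂ) (phiHat L f e k) * phiHat L f e k').re := by
  rw [phiHat_negDir hev, phiHat_negDir hev, Complex.conj_conj, re_mul_conj_swap]

omit [NeZero L] in
/-- a four-direction sum whose odd entries repeat the even ones. [folklore] -/
theorem sum_dir4 (X : ℕ → ℝ) (h1 : X 1 = X 0) (h3 : X 3 = X 2) : ∑ j ∈ range 4, X j = 2 * (X 0 + X 2) := by
  simp only [Finset.sum_range_succ, Finset.sum_range_zero, h1, h3]
  ring

end FinXB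

end Summit.HubbardSuperconductivity.HubbardSuperconductivity.Theorems.AnisotropyChord.Transfer.Fibre3
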